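import Summits.QuantumFields.YangMills.Theorems.UnitScaleGibbsTestFieldSU2DressingPush
import Summits.QuantumFields.YangMills.Theorems.UnitScaleGibbsActionDerivFlatPairing
import Literature.MathematicalPhysics.QuantumFieldTheory.Balaban1983to89.Node00.WilsonActionSecondVariationL2Letters
import HarnessLib

/-!
# `UnitScaleGibbsTestFieldSU2DressingFlatPairing` — THE SCHWINGER–DYSON OBSERVABLE OF THE DRESSED TEST FIELD IS THE SCALAR FLUX PAIRING:
# `|∂_{u_α}A_W(V) + ½·Σ_p (du⁰)_p·Re Tr(τ_α(V(∂p) − 1))| ≤ 14·(d−1)nθ·θ·2·Σ_p Σ_slots |u⁰|` (KNIT-PLAN P5 of `stub_linTest`, LINE 28 «GrossTransfer»;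
# FILE 3 of the dressing dictionary = X-KNIT-L ✓`UnitScaleGibbsActionDerivFlatPairing` INSTANTIATED AT `u_α b := (u⁰ b : ℂ) • (iσ_α)`)

Cell `ym3-torus` (YM ladder rung R3 = continuum SU(2) Yang–Mills on every three-torus — a RUNG, NOT d = 4, NOT infinite volume, NOT a mass gap, NOT the
Clay problem), crux of record `UnitScaleTilt.HistoryTailL` (stmt-QuantumFields-19936); LINE 28 «GrossTransfer» registered on stmt-QuantumFields-23083;
width seat `ym-ust-19936-w5` gen 17.  X-KNIT-L (★w2-19936 g15, ✓p744553) proves, for ANY `𝔰𝔲(N)`-valued `Y` vanishing off the inner box and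
`V = U^{axialGauge U lo hi}` on a `θ`-small box, `|actionDeriv (fundamentalRep) ↑Y V + (1∕N)Σ_p Re tr((Y_{b₀}+Y_{b₁}−Y_{b₂}−Y_{b₃})·(V(∂p) − 1))| ≤
14·((d−1)nθ)·θ·Σ_p Σ_slots ‖Y‖`.  KNIT-PLAN v2 (23083 evidence #12) S5-P5 needs it at the pen's dressed field `u_α = u⁰ ⊗ τ_α` with the pairing read as the SCALAR
curl `(du⁰)_p` times the Pauli trace `F^α_p = Re Tr(τ_α(V(∂p) − 1))` (LIN-ID's letter) and the error in `|u⁰|`.  THIS FILE (def-free, one configuration):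
§1 `mem_boxBonds_inner_of_row` (the skeleton's R3 letter ⇒ X-KNIT-L's support letter `boxBonds (lo+1) (hi−1)`), `slotBond_zero∕one∕two∕three`;
§2 ★★★`abs_actionDeriv_dress_add_half_fluxPairing_le` (the display, `N = 2`, via FILE 1's `ofReal_smul_I_smul_pauli_mem_lieSU`, `re_trace_dress_mul`,
`opNorm_ofReal_smul_I_smul_pauli_le`) and its `ℓ¹(bonds)` form ★`abs_actionDeriv_dress_add_half_fluxPairing_le_norm1` (error `56·(d−1)·((d−1)nθ)·θ·Σ_b |u⁰ b|`, by
Node00 ✓`sum_plaq_boundary_eq`: every bond lies on exactly `2(d−1)` plaquettes); §3 the PUSH currency (FILE 2's letters): the bond read-backs `sum_push_mul_eq_sum_box` (`Σ_b (A b)·G b = Σ_{x∈Π[lo,hi]}Σ_μ (a x μ)·G⟨castSite x,μ⟩`,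
every `G` — R7∕P7's `ω`-terms), `sum_push_comp_eq_sum_box` (`Σ_b φ(A b) = ΣΣ φ(a x μ)`, `φ 0 = 0`), `sum_abs_push_eq_sum_box` (`Σ_b |A b| = Σ_{x∈Π[lo,hi]}Σ_μ |a x μ|`),
and ★★★`abs_actionDeriv_push_dress_add_half_pairingZ_le` — for the dressed push of a margin-1 `ℤ^d` field `a`: `|actionDeriv ρ u_α V + ½·Σ_{z∈Π[lo,hi]}Σ_{μ<ν}
(curl a)(z,μ,ν)·F^α⟨castSite z,μ,ν⟩| ≤ 56·(d−1)·((d−1)nθ)·θ·Σ_{x∈Π[lo,hi]}Σ_μ |a x μ|` (KNIT-PLAN v2 S5-P5 in `ℤ³` currency, end to end).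
HONEST SCOPE.  Bookkeeping over X-KNIT-L; proves no stub and closes no item.  Nothing of `stub_linTest`, «ShallowFluxSecondMomentL», (Q), 23083∕23133∕23134, K1,
`stub_pinnedStep`∕`stub_unitEnvelope` or `HistoryTailL` is proved.  YM₃ on T³ is rung R3 — NOT d = 4, NOT a mass gap, NOT Clay.
References: L. Gross, CMP **92** (1983) 137–162, Thm 2.2 [GrossCMP1983]; T. Bałaban, CMP **99** (1985) 389–434, (3.6)–(3.7) p. 391
[Balaban1985BackgroundPropagators]; CMP **102** (1985) 255–275, p. 260 [Balaban1985UV3].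
-/

set_option autoImplicit false

noncomputable section

open scoped BigOperators Matrix Matrix.Norms.L2Operator
open Complex Finset
open Literature.MathematicalPhysics.QuantumFieldTheory.Balaban1983to89
open Literature.MathematicalPhysics.QuantumFieldTheory.Balaban1983to89.T4AxialGaugeSmallField (castSite boxPlaqs boxBonds axialGauge)
open Literature.MathematicalPhysics.QuantumFieldTheory.Balaban1983to89.B7Prop1Explicit (e)
open Literature.MathematicalPhysics.QuantumFieldTheory.Balaban1983to89.B10Eq18SigmaSU2 (pauli)
open Literature.MathematicalPhysics.QuantumFieldTheory.Balaban1983to89.T4AdjointCovarianceUnitary (lieSU)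
open Literature.MathematicalPhysics.QuantumLattice (fundamentalRep)
open Summit.QuantumFields.YangMills.Theorems.UnitScaleGibbsActionDerivativeSlotCalculus (slotBond actionDeriv)
open Summit.QuantumFields.YangMills.Theorems.UnitScaleGibbsActionDerivFlatPairing (abs_actionDeriv_axialGaugeRep_sub_flatPairing_le)
open Literature.MathematicalPhysics.QuantumFieldTheory.Balaban1983to89.B4Eq19LatticeOperators (Zd unitVec)
open Literature.MathematicalPhysics.QuantumFieldTheory.Balaban1983to89.Node00 (sum_plaq_boundary_eq)
open Summit.QuantumFields.YangMills.Theorems.UnitScaleGibbsTestFieldSU2Dressing (ofReal_smul_I_smul_pauli_mem_lieSU re_trace_dress_mul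
  opNorm_ofReal_smul_I_smul_pauli_le)
open Summit.QuantumFields.YangMills.Theorems.UnitScaleGibbsTemporalGaugePrimitiveTorus (sum_pbond_eq_sum_box)
open Summit.QuantumFields.YangMills.Theorems.UnitScaleGibbsTestFieldSU2DressingPush (mem_piFinset_Icc_iff push_eq_zero_of_not_le
  eq_zero_of_not_le push_support_margin_of_margin1 sum_curl_push_mul_eq_sum_box)

namespace Summit.QuantumFields.YangMills.Theorems.UnitScaleGibbsTestFieldSU2DressingFlatPairing

variable {P : Params} {j : ℕ}

/-! ## §1 Letters: the skeleton's support row is X-KNIT-L's support letter; the four slots -/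

/-- **R3 ⇒ X-KNIT-L's support letter**: `lo + 1 ≤ x`, `x + e b.dir + 1 ≤ hi`, `b.src = castSite x` put `b` in `boxBonds (lo + 1) (hi − 1)`. [folklore] -/
theorem mem_boxBonds_inner_of_row {lo hi : Fin P.d → ℤ} (b : PBond P j)
    (h : ∃ x : Fin P.d → ℤ, lo + 1 ≤ x ∧ x + e b.dir + 1 ≤ hi ∧ b.src = castSite x) :
    b ∈ (boxBonds (lo + 1) (hi - 1) : Set (PBond P j)) := by
  obtain ⟨x, h1, h2, h3⟩ := h
  refine ⟨x, h1, fun i => ?_, h3⟩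
  have h2i : x i + (e b.dir : Fin P.d → ℤ) i + 1 ≤ hi i := h2 i
  show x i + (e b.dir : Fin P.d → ℤ) i ≤ hi i - 1
  omega

/-- Slot `0` of `p` is `⟨p.src, p.μ⟩`. [folklore] -/
theorem slotBond_zero (p : Plaq P j) : slotBond p 0 = ⟨p.src, p.μ⟩ := rfl
/-- Slot `1` of `p` is `⟨p.src + e_μ, p.ν⟩`. [folklore] -/
theorem slotBond_one (p : Plaq P j) : slotBond p 1 = ⟨p.src.shift p.μ, p.ν⟩ := rfl
/-- Slot `2` of `p` is `⟨p.src + e_ν, p.μ⟩`. [folklore] -/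
theorem slotBond_two (p : Plaq P j) : slotBond p 2 = ⟨p.src.shift p.ν, p.μ⟩ := rfl
/-- Slot `3` of `p` is `⟨p.src, p.ν⟩`. [folklore] -/
theorem slotBond_three (p : Plaq P j) : slotBond p 3 = ⟨p.src, p.ν⟩ := rfl

/-! ## §2 X-KNIT-L at the dressed field -/

/-- ★★★ **THE SCHWINGER–DYSON OBSERVABLE OF THE DRESSED TEST FIELD IS THE SCALAR FLUX PAIRING, UP TO THE BOX ERROR.**  On a `θ`-small box
(`PlaqSmallOn (boxPlaqs lo hi) θ U`, side `n < sitesPerDir j`), with `V := U^{axialGauge U lo hi}`, for a real bond function `u⁰` whose support obeys the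
skeleton's margin row (R3 without the gauge clause) and the dressed field `u_α b := (u⁰ b : ℂ) • τ_α`:
`|actionDeriv (fundamentalRep (Fin 2)) u_α V + ½·Σ_p (du⁰)_p · Re Tr(τ_α·(V(∂p) − 1))| ≤ 14·((d−1)·n·θ)·θ·(2·Σ_p Σ_{i<4} |u⁰(slotBond p i)|)`
(X-KNIT-L ✓`abs_actionDeriv_axialGaugeRep_sub_flatPairing_le` at `Y b := ⟨u_α b, τ_α ∈ 𝔰𝔲(2)⟩`, `card (Fin 2) = 2`, `Re Tr((du_α)_p X) = (du⁰)_p·Re Tr(τ_α X)`,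
`‖u_α b‖ ≤ 2|u⁰ b|`). [cite: GrossCMP1983, Thm 2.2] [cite: Balaban1985BackgroundPropagators, (3.7) p.391] -/
theorem abs_actionDeriv_dress_add_half_fluxPairing_le (U : GaugeField P j (Matrix.specialUnitaryGroup (Fin 2) ℂ))
    {lo hi : Fin P.d → ℤ} {θ : ℝ} {n : ℕ}
    (hU : PlaqSmallOn (boxPlaqs lo hi) θ U) (hθ : 0 ≤ θ) (hn : ∀ κ, hi κ ≤ lo κ + n) (hnN : n < P.sitesPerDir j)
    (u0 : PBond P j → ℝ) (α : Fin 3)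
    (hsupp : ∀ b : PBond P j, u0 b ≠ 0 → ∃ x : Fin P.d → ℤ, lo + 1 ≤ x ∧ x + e b.dir + 1 ≤ hi ∧ b.src = castSite x) :
    |actionDeriv (fundamentalRep (Fin 2)) (fun b => ((u0 b : ℝ) : ℂ) • (I • pauli α)) (GaugeField.gaugeAct (axialGauge U lo hi) U)
        + (1 / 2) * ∑ p : Plaq P j, (u0 (slotBond p 0) + u0 (slotBond p 1) - u0 (slotBond p 2) - u0 (slotBond p 3)) *
            ((I • pauli α) * (((GaugeField.plaqHol (GaugeField.gaugeAct (axialGauge U lo hi) U) p :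
              Matrix.specialUnitaryGroup (Fin 2) ℂ) : Matrix (Fin 2) (Fin 2) ℂ) - 1)).trace.re|
      ≤ 14 * ((((P.d - 1 : ℕ) : ℝ) * n * θ)) * θ *
          (2 * ∑ p : Plaq P j, (|u0 (slotBond p 0)| + |u0 (slotBond p 1)| + |u0 (slotBond p 2)| + |u0 (slotBond p 3)|)) := by
  -- the dressed field as an `𝔰𝔲(2)`-valued field
  set Y : PBond P j → lieSU (Fin 2) := fun b => ⟨((u0 b : ℝ) : ℂ) • (I • pauli α), ofReal_smul_I_smul_pauli_mem_lieSU _ α⟩ with hY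
  have hYcoe : ∀ b, (Y b : Matrix (Fin 2) (Fin 2) ℂ) = ((u0 b : ℝ) : ℂ) • (I • pauli α) := fun _ => rfl
  have hYsupp : ∀ b : PBond P j, b ∉ (boxBonds (lo + 1) (hi - 1) : Set (PBond P j)) → Y b = 0 := by
    intro b hb
    by_contra hne
    have h0 : u0 b ≠ 0 := by
      intro h0
      apply hne
      ext1
      rw [hYcoe, h0, Complex.ofReal_zero, zero_smul]
      rfl
    exact hb (mem_boxBonds_inner_of_row b (hsupp b h0))
  have hX := abs_actionDeriv_axialGaugeRep_sub_flatPairing_le U hU hθ hn hnN Y hYsupp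
  -- abbreviation for the dressed configuration
  set V := GaugeField.gaugeAct (axialGauge U lo hi) U with hV
  -- the pairing summand of X-KNIT-L is the scalar curl times the Pauli trace
  have htr : ∀ p : Plaq P j,
      (((Y ⟨p.src, p.μ⟩ : Matrix (Fin 2) (Fin 2) ℂ) + (Y ⟨p.src.shift p.μ, p.ν⟩ : Matrix (Fin 2) (Fin 2) ℂ)
          - (Y ⟨p.src.shift p.ν, p.μ⟩ : Matrix (Fin 2) (Fin 2) ℂ) - (Y ⟨p.src, p.ν⟩ : Matrix (Fin 2) (Fin 2) ℂ)) *
          (((GaugeField.plaqHol V p : Matrix.specialUnitaryGroup (Fin 2) ℂ) : Matrix (Fin 2) (Fin 2) ℂ) - 1)).trace.re =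
        (u0 (slotBond p 0) + u0 (slotBond p 1) - u0 (slotBond p 2) - u0 (slotBond p 3)) *
          ((I • pauli α) * (((GaugeField.plaqHol V p : Matrix.specialUnitaryGroup (Fin 2) ℂ) : Matrix (Fin 2) (Fin 2) ℂ) - 1)).trace.re := by
    intro p
    rw [hYcoe, hYcoe, hYcoe, hYcoe, ← re_trace_dress_mul]
    congr 3
    rw [slotBond_zero, slotBond_one, slotBond_two, slotBond_three]
    push_cast
    simp only [add_smul, sub_smul]
  have hfun : (fun b => (Y b : Matrix (Fin 2) (Fin 2) ℂ)) = fun b => ((u0 b : ℝ) : ℂ) • (I • pauli α) := rfl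
  have hcard : (Fintype.card (Fin 2) : ℝ) = 2 := by simp
  rw [hfun, hcard] at hX
  simp only [htr] at hX
  -- the error term: `‖u_α b‖ ≤ 2|u⁰ b|`
  have hcoef : 0 ≤ 14 * ((((P.d - 1 : ℕ) : ℝ) * n * θ)) * θ := by positivity
  have herr : ∑ p : Plaq P j, (‖(Y ⟨p.src, p.μ⟩ : Matrix (Fin 2) (Fin 2) ℂ)‖ + ‖(Y ⟨p.src.shift p.μ, p.ν⟩ : Matrix (Fin 2) (Fin 2) ℂ)‖
        + ‖(Y ⟨p.src.shift p.ν, p.μ⟩ : Matrix (Fin 2) (Fin 2) ℂ)‖ + ‖(Y ⟨p.src, p.ν⟩ : Matrix (Fin 2) (Fin 2) ℂ)‖) ≤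
      2 * ∑ p : Plaq P j, (|u0 (slotBond p 0)| + |u0 (slotBond p 1)| + |u0 (slotBond p 2)| + |u0 (slotBond p 3)|) := by
    rw [Finset.mul_sum]
    refine Finset.sum_le_sum fun p _ => ?_
    rw [hYcoe, hYcoe, hYcoe, hYcoe, slotBond_zero, slotBond_one, slotBond_two, slotBond_three]
    have h0 := opNorm_ofReal_smul_I_smul_pauli_le (u0 ⟨p.src, p.μ⟩) α
    have h1 := opNorm_ofReal_smul_I_smul_pauli_le (u0 ⟨p.src.shift p.μ, p.ν⟩) α
    have h2 := opNorm_ofReal_smul_I_smul_pauli_le (u0 ⟨p.src.shift p.ν, p.μ⟩) α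
    have h3 := opNorm_ofReal_smul_I_smul_pauli_le (u0 ⟨p.src, p.ν⟩) α
    linarith
  -- assemble
  have hlhs : actionDeriv (fundamentalRep (Fin 2)) (fun b => ((u0 b : ℝ) : ℂ) • (I • pauli α)) V
        + (1 / 2) * ∑ p : Plaq P j, (u0 (slotBond p 0) + u0 (slotBond p 1) - u0 (slotBond p 2) - u0 (slotBond p 3)) *
            ((I • pauli α) * (((GaugeField.plaqHol V p : Matrix.specialUnitaryGroup (Fin 2) ℂ) : Matrix (Fin 2) (Fin 2) ℂ) - 1)).trace.re =
      actionDeriv (fundamentalRep (Fin 2)) (fun b => ((u0 b : ℝ) : ℂ) • (I • pauli α)) V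
        - -(∑ p : Plaq P j, (u0 (slotBond p 0) + u0 (slotBond p 1) - u0 (slotBond p 2) - u0 (slotBond p 3)) *
            ((I • pauli α) * (((GaugeField.plaqHol V p : Matrix.specialUnitaryGroup (Fin 2) ℂ) : Matrix (Fin 2) (Fin 2) ℂ) - 1)).trace.re) / 2 := by
    ring
  rw [hlhs]
  exact hX.trans (mul_le_mul_of_nonneg_left herr hcoef)

/-- ★ **`ℓ¹(bonds)` FORM**: the same with the error `14·((d−1)nθ)·θ·(4(d−1)·Σ_b |u⁰ b|)` — every bond lies on exactly `2(d−1)` plaquettes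
(Node00 ✓`sum_plaq_boundary_eq`). [cite: Balaban1985Averaging, (20) p.21] -/
theorem abs_actionDeriv_dress_add_half_fluxPairing_le_norm1 (U : GaugeField P j (Matrix.specialUnitaryGroup (Fin 2) ℂ))
    {lo hi : Fin P.d → ℤ} {θ : ℝ} {n : ℕ}
    (hU : PlaqSmallOn (boxPlaqs lo hi) θ U) (hθ : 0 ≤ θ) (hn : ∀ κ, hi κ ≤ lo κ + n) (hnN : n < P.sitesPerDir j)
    (u0 : PBond P j → ℝ) (α : Fin 3)
    (hsupp : ∀ b : PBond P j, u0 b ≠ 0 → ∃ x : Fin P.d → ℤ, lo + 1 ≤ x ∧ x + e b.dir + 1 ≤ hi ∧ b.src = castSite x) :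
    |actionDeriv (fundamentalRep (Fin 2)) (fun b => ((u0 b : ℝ) : ℂ) • (I • pauli α)) (GaugeField.gaugeAct (axialGauge U lo hi) U)
        + (1 / 2) * ∑ p : Plaq P j, (u0 (slotBond p 0) + u0 (slotBond p 1) - u0 (slotBond p 2) - u0 (slotBond p 3)) *
            ((I • pauli α) * (((GaugeField.plaqHol (GaugeField.gaugeAct (axialGauge U lo hi) U) p :
              Matrix.specialUnitaryGroup (Fin 2) ℂ) : Matrix (Fin 2) (Fin 2) ℂ) - 1)).trace.re|
      ≤ 14 * ((((P.d - 1 : ℕ) : ℝ) * n * θ)) * θ * (4 * ((P.d : ℝ) - 1) * ∑ b : PBond P j, |u0 b|) := by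
  refine (abs_actionDeriv_dress_add_half_fluxPairing_le U hU hθ hn hnN u0 α hsupp).trans (le_of_eq ?_)
  congr 1
  have h := sum_plaq_boundary_eq (P := P) (j := j) (fun b => |u0 b|)
  simp only [slotBond_zero, slotBond_one, slotBond_two, slotBond_three]
  rw [h]
  ring

/-! ## §3 The push currency: S5-P5 for the dressed push of a margin-1 `ℤ^d` field, end to end -/

/-- **BOND READ-BACK, WEIGHTED**: for EVERY torus bond function `G`, `Σ_b (A b)·G b = Σ_{x ∈ Π[lo,hi]} Σ_μ (a x μ)·G⟨castSite x, μ⟩` (margin row) — the bond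
analogue of ✓`sum_curl_push_mul_eq_sum_box` (KNIT-PLAN v2 R7∕P7: the collar weights `ω = push(192·W·|δσ|)` against `dist₁((VU) b)²` read on `ℤ³`).
[cite: Balaban1984PropagatorsI, (1.10) p.19] -/
theorem sum_push_mul_eq_sum_box {lo hi : Fin P.d → ℤ} (hN : ∀ κ, hi κ - lo κ < P.sitesPerDir j)
    (a : Zd P.d → Fin P.d → ℝ) (ha1 : ∀ x μ, a x μ ≠ 0 → lo + 1 ≤ x ∧ x + unitVec μ + 1 ≤ hi)
    (A : PBond P j → ℝ)
    (hA : ∀ (x : Fin P.d → ℤ) (μ : Fin P.d), lo ≤ x → x + e μ ≤ hi → A ⟨castSite x, μ⟩ = a x μ)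
    (hA0 : ∀ b : PBond P j, (¬ ∃ y : Fin P.d → ℤ, lo ≤ y ∧ y + e b.dir ≤ hi ∧ b.src = castSite y) → A b = 0)
    (G : PBond P j → ℝ) :
    ∑ b : PBond P j, A b * G b = ∑ x ∈ Fintype.piFinset (fun i => Finset.Icc (lo i) (hi i)), ∑ μ : Fin P.d, a x μ * G ⟨castSite x, μ⟩ := by
  classical
  rw [sum_pbond_eq_sum_box hN (fun b : PBond P j => A b * G b)
    (fun b hb => by
      by_cases h : ∃ y : Fin P.d → ℤ, lo ≤ y ∧ y + e b.dir ≤ hi ∧ b.src = castSite y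
      · exact h
      · exact absurd (by rw [hA0 b h, zero_mul]) hb)]
  refine Finset.sum_congr rfl fun x hx => Finset.sum_congr rfl fun μ _ => ?_
  obtain ⟨hxlo, hxhi⟩ := (mem_piFinset_Icc_iff x).1 hx
  by_cases hin : x + e μ ≤ hi
  · rw [hA x μ hxlo hin]
  · rw [push_eq_zero_of_not_le hN A hA0 hxlo hxhi hin, eq_zero_of_not_le a ha1 hin]

/-- **BOND READ-BACK THROUGH A FUNCTION VANISHING AT `0`**: `Σ_b φ(A b) = Σ_{x ∈ Π[lo,hi]} Σ_μ φ(a x μ)` (`φ 0 = 0`; margin row) — `φ = id` reads the collar floor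
`Σ_b ω b`, `φ = |·|` the `ℓ¹` mass, `φ = (·)²` is FILE 2's `sum_sq_push_eq_sum_box`. [cite: Balaban1984PropagatorsI, (1.10) p.19] -/
theorem sum_push_comp_eq_sum_box {M : Type*} [AddCommMonoid M] {lo hi : Fin P.d → ℤ} (hN : ∀ κ, hi κ - lo κ < P.sitesPerDir j)
    (a : Zd P.d → Fin P.d → ℝ) (ha1 : ∀ x μ, a x μ ≠ 0 → lo + 1 ≤ x ∧ x + unitVec μ + 1 ≤ hi)
    (A : PBond P j → ℝ)
    (hA : ∀ (x : Fin P.d → ℤ) (μ : Fin P.d), lo ≤ x → x + e μ ≤ hi → A ⟨castSite x, μ⟩ = a x μ)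
    (hA0 : ∀ b : PBond P j, (¬ ∃ y : Fin P.d → ℤ, lo ≤ y ∧ y + e b.dir ≤ hi ∧ b.src = castSite y) → A b = 0)
    (φ : ℝ → M) (hφ : φ 0 = 0) :
    ∑ b : PBond P j, φ (A b) = ∑ x ∈ Fintype.piFinset (fun i => Finset.Icc (lo i) (hi i)), ∑ μ : Fin P.d, φ (a x μ) := by
  classical
  rw [sum_pbond_eq_sum_box hN (fun b : PBond P j => φ (A b))
    (fun b hb => by
      by_cases h : ∃ y : Fin P.d → ℤ, lo ≤ y ∧ y + e b.dir ≤ hi ∧ b.src = castSite y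
      · exact h
      · exact absurd (by rw [hA0 b h, hφ]) hb)]
  refine Finset.sum_congr rfl fun x hx => Finset.sum_congr rfl fun μ _ => ?_
  obtain ⟨hxlo, hxhi⟩ := (mem_piFinset_Icc_iff x).1 hx
  by_cases hin : x + e μ ≤ hi
  · rw [hA x μ hxlo hin]
  · rw [push_eq_zero_of_not_le hN A hA0 hxlo hxhi hin, eq_zero_of_not_le a ha1 hin]

/-- **`ℓ¹` read-out of a push**: `Σ_b |A b| = Σ_{x ∈ Π[lo,hi]} Σ_μ |a x μ|` (margin row). [cite: Balaban1984PropagatorsI, (1.10) p.19] -/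
theorem sum_abs_push_eq_sum_box {lo hi : Fin P.d → ℤ} (hN : ∀ κ, hi κ - lo κ < P.sitesPerDir j)
    (a : Zd P.d → Fin P.d → ℝ) (ha1 : ∀ x μ, a x μ ≠ 0 → lo + 1 ≤ x ∧ x + unitVec μ + 1 ≤ hi)
    (A : PBond P j → ℝ)
    (hA : ∀ (x : Fin P.d → ℤ) (μ : Fin P.d), lo ≤ x → x + e μ ≤ hi → A ⟨castSite x, μ⟩ = a x μ)
    (hA0 : ∀ b : PBond P j, (¬ ∃ y : Fin P.d → ℤ, lo ≤ y ∧ y + e b.dir ≤ hi ∧ b.src = castSite y) → A b = 0) :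
    ∑ b : PBond P j, |A b| = ∑ x ∈ Fintype.piFinset (fun i => Finset.Icc (lo i) (hi i)), ∑ μ : Fin P.d, |a x μ| :=
  sum_push_comp_eq_sum_box hN a ha1 A hA hA0 (fun r : ℝ => |r|) abs_zero

/-- ★★★ **S5-P5 IN `ℤ^d` CURRENCY, END TO END.**  On a `θ`-small NON-WRAPPING box (`PlaqSmallOn (boxPlaqs lo hi) θ U`, `hi κ ≤ lo κ + n`, `n < sitesPerDir j`),
with `V := U^{axialGauge U lo hi}`, for a `ℤ^d` bond field `a` with the margin-1 row `a x μ ≠ 0 → lo + 1 ≤ x ∧ x + e_μ + 1 ≤ hi`, any push `A` of `a`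
(the two reading rows of ✓`exists_push`) and the dressed field `u_α b := (A b : ℂ) • τ_α`:
`|actionDeriv (fundamentalRep (Fin 2)) u_α V + ½·Σ_{z∈Π[lo,hi]} Σ_{μ<ν} ((a(z+e_μ,ν) − a(z,ν)) − (a(z+e_ν,μ) − a(z,μ)))·Re Tr(τ_α(V(∂⟨castSite z,μ,ν⟩) − 1))|
≤ 14·((d−1)nθ)·θ·(4(d−1)·Σ_{x∈Π[lo,hi]} Σ_μ |a x μ|)` — X-KNIT-L's Schwinger–Dyson row for the pen's test field with the pairing AND the error read on `ℤ³`
(KNIT-D ∕ (Z-e) letters). [cite: GrossCMP1983, Thm 2.2] [cite: Balaban1985BackgroundPropagators, (3.7) p.391] -/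
theorem abs_actionDeriv_push_dress_add_half_pairingZ_le (U : GaugeField P j (Matrix.specialUnitaryGroup (Fin 2) ℂ))
    {lo hi : Fin P.d → ℤ} {θ : ℝ} {n : ℕ}
    (hU : PlaqSmallOn (boxPlaqs lo hi) θ U) (hθ : 0 ≤ θ) (hn : ∀ κ, hi κ ≤ lo κ + n) (hnN : n < P.sitesPerDir j)
    (hN : ∀ κ, hi κ - lo κ < P.sitesPerDir j)
    (a : Zd P.d → Fin P.d → ℝ) (ha1 : ∀ x μ, a x μ ≠ 0 → lo + 1 ≤ x ∧ x + unitVec μ + 1 ≤ hi)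
    (A : PBond P j → ℝ)
    (hA : ∀ (x : Fin P.d → ℤ) (μ : Fin P.d), lo ≤ x → x + e μ ≤ hi → A ⟨castSite x, μ⟩ = a x μ)
    (hA0 : ∀ b : PBond P j, (¬ ∃ y : Fin P.d → ℤ, lo ≤ y ∧ y + e b.dir ≤ hi ∧ b.src = castSite y) → A b = 0) (α : Fin 3) :
    |actionDeriv (fundamentalRep (Fin 2)) (fun b => ((A b : ℝ) : ℂ) • (I • pauli α)) (GaugeField.gaugeAct (axialGauge U lo hi) U)
        + (1 / 2) * ∑ z ∈ Fintype.piFinset (fun i => Finset.Icc (lo i) (hi i)), ∑ q : {q : Fin P.d × Fin P.d // q.1 < q.2},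
            ((a (z + unitVec q.1.1) q.1.2 - a z q.1.2) - (a (z + unitVec q.1.2) q.1.1 - a z q.1.1)) *
              ((I • pauli α) * (((GaugeField.plaqHol (GaugeField.gaugeAct (axialGauge U lo hi) U) ⟨castSite z, q.1.1, q.1.2, q.2⟩ :
                Matrix.specialUnitaryGroup (Fin 2) ℂ) : Matrix (Fin 2) (Fin 2) ℂ) - 1)).trace.re|
      ≤ 14 * ((((P.d - 1 : ℕ) : ℝ) * n * θ)) * θ *
          (4 * ((P.d : ℝ) - 1) * ∑ x ∈ Fintype.piFinset (fun i => Finset.Icc (lo i) (hi i)), ∑ μ : Fin P.d, |a x μ|) := by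
  have hsupp : ∀ b : PBond P j, A b ≠ 0 → ∃ x : Fin P.d → ℤ, lo + 1 ≤ x ∧ x + e b.dir + 1 ≤ hi ∧ b.src = castSite x :=
    push_support_margin_of_margin1 a ha1 A hA hA0
  have hpair := sum_curl_push_mul_eq_sum_box hN a ha1 A hA hA0
    (fun p => ((I • pauli α) * (((GaugeField.plaqHol (GaugeField.gaugeAct (axialGauge U lo hi) U) p :
      Matrix.specialUnitaryGroup (Fin 2) ℂ) : Matrix (Fin 2) (Fin 2) ℂ) - 1)).trace.re)
  beta_reduce at hpair
  rw [← hpair, ← sum_abs_push_eq_sum_box hN a ha1 A hA hA0]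
  exact abs_actionDeriv_dress_add_half_fluxPairing_le_norm1 U hU hθ hn hnN A α hsupp

end Summit.QuantumFields.YangMills.Theorems.UnitScaleGibbsTestFieldSU2DressingFlatPairing

end
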